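import Summits.BirchSwinnertonDyer.BirchSwinnertonDyer.Theorems.CMKolyvaginAtInertTwoTorsionLocalKerIndexTwoAtTwo
import Summits.BirchSwinnertonDyer.BirchSwinnertonDyer.Theorems.GenusKolyvaginAtTwoPowDvdShaCardAtTwoRTGenusKernel
import HarnessLib

/-!
# Route `CMKolyvaginAtInertTwo`, crux `CMKolyvaginExactAtInertTwo` (stmt-BirchSwinnertonDyer-24277):
# T2 local input, step 3 — the strict local kernels of `H¹(K, E[n])` at `E` and at a QUADRATIC
# extension `E'/E` coincide as soon as `H¹(Gal(E'/E), E(K̄_E)[n]^{Γ_{E'}}) = 0` (stated as the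
# solvability `m + σm = 0 ⟹ m = σx − x` for the Frobenius-type lifts `σ ∉ Γ_{E'}`)

Seat `bsd-line-cmk2-p1` g15 (cell `bsd-print-cf2`); helper (`--supports stmt-BirchSwinnertonDyer-24277`).
THEOREMS ONLY: no definition, no named fact, no `sorry`; no item is closed; BSD is not proved by this.

Step 2 (`torsionLocalKer_eq_of_index_two`) asked for index-two data on `Γ_{E'} → Γ_E`. For a
quadratic extension `E'/E` of characteristic-`0` fields that data is in the tree (gk2-p2 g17,
`GenusExact.PlusDescent.exists_indexTwo_setup`: `galRange E'` is open, normal, of index `2`, with a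
coset generator `σ`), and the tower map on `n`-torsion points along the chosen embedding
`K̄_E → K̄_{E'}` is bijective (both are algebraic closures of `E`). So ALL the structural
hypotheses are discharged, and the equality of strict local kernels
`W.torsionLocalKer E n = W.torsionLocalKer E' n` holds given only the module-theoretic input
**`∀ σ ∉ galRange E', ∀ m ∈ E(K̄_E)[n]^{galRange E'}, m + σm = 0 ⟹ ∃ x ∈ E(K̄_E)[n]^{galRange E'}, σx − x = m`**
— at an inert Kolyvagin prime `ℓ` of depth `M+1` (`E = ℚ_ℓ`, `E' = K_λ`, `n = 2^M`) this is the
regular-`C₂`-module computation `exists_smul_sub_eq_of_regular` once `galRange K_λ` is known to act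
trivially on `E[2^M]` and `σ` as complex conjugation does (the two remaining ARITHMETIC inputs).

* `torsionLocalKer_eq_of_finrank_eq_two`.

References: Serre, *Galois Cohomology* I.§2.4, I.§5.8, II.§1.1; Gross 1991 §9; McCallum 1991 §3.
-/

-- single-conjunct summit: `Summit.BirchSwinnertonDyer.BirchSwinnertonDyer.…` repeats the name by design
set_option linter.dupNamespace false
set_option autoImplicit false

noncomputable section

open scoped Classical

universe u

open Literature.NumberTheory.EllipticCurves Literature.NumberTheory.GaloisRepresentations WeierstrassCurve
  Summit.BirchSwinnertonDyer.BirchSwinnertonDyer.Theorems.GenusExact.PlusDescent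

namespace Summit.BirchSwinnertonDyer.BirchSwinnertonDyer.Theorems.KolyvaginInfResTwo

section Quadratic

variable {K : Type u} [Field K] (W : WeierstrassCurve K)
variable {E : Type u} [Field E] [Algebra K E] [CharZero E]
variable {E' : Type u} [Field E'] [Algebra K E'] [Algebra E E'] [IsScalarTower K E E']
  [FiniteDimensional E E']

/-- **Strict local kernels coincide across a quadratic step, modulo `H¹(C₂, E(K̄_E)[n]^{Γ_{E'}}) = 0`.**
`W/K`; `K`-fields `E → E'` with `[E' : E] = 2` and a non-trivial `E`-automorphism `τ` of `E'` (`E` of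
characteristic `0`). If for every `σ ∈ Γ_E ∖ galRange E'` and every `n`-torsion point `m` of
`E(K̄_E)` fixed by `galRange E'` with `m + σm = 0` there is a `galRange E'`-fixed `x` with
`σx − x = m`, then `ker (H¹(K,E[n]) → H¹(E, ·)) = ker (H¹(K,E[n]) → H¹(E', ·))`
(`W.torsionLocalKer E n = W.torsionLocalKer E' n`). Proof: `galRange E'` is open normal of index `2`
with coset generator `σ` (`exists_indexTwo_setup`), the tower map on `n`-torsion along the chosen
`K̄_E → K̄_{E'}` is bijective (`algHom_algebraicClosure_bijective`), and step 2
`torsionLocalKer_eq_of_index_two`. [cite: SerreGaloisCohomology1997, I.§5.8 and II.§1.1]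
[cite: GrossLMS1991, §9 (local conditions at λ)] [cite: McCallumLMS1991, §3 (3)] -/
theorem torsionLocalKer_eq_of_finrank_eq_two (h2 : Module.finrank E E' = 2) (τ : E' ≃ₐ[E] E')
    (hτ : τ ≠ 1) (n : ℤ)
    (hsolv : ∀ σ : Field.absoluteGaloisGroup E, σ ∉ galRange (K := E) E' →
      ∀ m : AddSubgroup.torsionBy (localPoints W E) n, (∀ g ∈ galRange (K := E) E', g • m = m) →
        m + σ • m = 0 → ∃ x : AddSubgroup.torsionBy (localPoints W E) n,
          (∀ g ∈ galRange (K := E) E', g • x = x) ∧ σ • x - x = m) :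
    W.torsionLocalKer E n = W.torsionLocalKer E' n := by
  haveI : Algebra.IsAlgebraic E E' := Algebra.IsAlgebraic.of_finite E E'
  obtain ⟨σ, -, -, hNn, hNopen, -, hσ, -, -, -, -⟩ := exists_indexTwo_setup (W.baseChange E) E' h2 τ hτ
  haveI := hNn
  set N : Subgroup (Field.absoluteGaloisGroup E) := galRange (K := E) E' with hN
  -- the coset generator: `σ ∉ N`, `σ² ∈ N`, `Γ_E = N ∪ σN`
  have hσN : σ ∉ N := by
    intro h
    rcases hσ 1 with ⟨-, h1⟩ | ⟨-, h1⟩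
    · exact h1 N.one_mem
    · exact h1 (by rwa [one_mul])
  have hτ2 : σ * σ ∈ N := by
    rcases hσ σ with ⟨h, -⟩ | ⟨h, -⟩
    · exact h
    · exact absurd h hσN
  have hcov : ∀ g : Field.absoluteGaloisGroup E, g ∈ N ∨ σ⁻¹ * g ∈ N := by
    intro g
    by_cases hg : g ∈ N
    · exact Or.inl hg
    · right
      rcases hσ (σ⁻¹ * g) with ⟨h, hn⟩ | ⟨h, -⟩
      · exfalso
        apply hg
        have := hNn.conj_mem _ h σ
        rwa [show σ * (σ⁻¹ * g * σ) * σ⁻¹ = g by group] at this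
      · exact h
  -- the tower map on `n`-torsion along the chosen embedding, bijective
  let ι₂ : AlgebraicClosure E →ₐ[E] AlgebraicClosure E' := closureEmb (K := E) E'
  let ψ₂ : AddSubgroup.torsionBy (localPoints W E) n →+ AddSubgroup.torsionBy (localPoints W E') n :=
    ((pointsMapTower W ι₂).comp (AddSubgroup.torsionBy (localPoints W E) n).subtype).codRestrict _
      fun Q ↦ by
        rw [mem_torsionBy_iff, AddMonoidHom.coe_comp, AddSubgroup.coe_subtype, Function.comp_apply,
          ← map_zsmul, mem_torsionBy_iff.mp Q.2, map_zero]
  have hψ₂val : ∀ Q : AddSubgroup.torsionBy (localPoints W E) n,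
      (ψ₂ Q : localPoints W E') = pointsMapTower W ι₂ (Q : localPoints W E) := fun _ ↦ rfl
  have hψ₂ : ∀ (x : Field.absoluteGaloisGroup E') (Q : AddSubgroup.torsionBy (localPoints W E) n),
      ψ₂ (resGalOfEmb (K := E) ι₂ x • Q) = x • ψ₂ Q := fun x Q ↦
    Subtype.ext (pointsMapTower_smul W ι₂ x (Q : localPoints W E))
  have hinjT : Function.Injective (pointsMapTower W ι₂) :=
    WeierstrassCurve.Affine.Point.map_injective _
  have hsurjT : Function.Surjective (pointsMapTower W ι₂) := by
    intro P
    let e := algEquivOfEmb E' ι₂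
    refine ⟨WeierstrassCurve.Affine.Point.map
      ((e.symm : AlgebraicClosure E' →ₐ[E] AlgebraicClosure E).restrictScalars K)
      (show (W.baseChange (AlgebraicClosure E')).toAffine.Point from P), ?_⟩
    change WeierstrassCurve.Affine.Point.map (ι₂.restrictScalars K)
      (WeierstrassCurve.Affine.Point.map _ _) = _
    rw [WeierstrassCurve.Affine.Point.map_map]
    have hc : (ι₂.restrictScalars K).comp
        ((e.symm : AlgebraicClosure E' →ₐ[E] AlgebraicClosure E).restrictScalars K) =
        AlgHom.id K (AlgebraicClosure E') := by
      ext z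
      exact e.apply_symm_apply z
    rw [hc]
    rcases P with _ | _ <;> rfl
  have hbij : Function.Bijective ψ₂ := by
    refine ⟨fun P Q h ↦ Subtype.ext (hinjT (by
      have := congrArg (fun R : AddSubgroup.torsionBy (localPoints W E') n ↦ (R : localPoints W E')) h
      simpa [hψ₂val] using this)), fun R ↦ ?_⟩
    obtain ⟨P, hP⟩ := hsurjT (R : localPoints W E')
    have hPn : P ∈ AddSubgroup.torsionBy (localPoints W E) n := by
      rw [mem_torsionBy_iff]
      apply hinjT
      rw [map_zsmul, hP, map_zero]
      exact mem_torsionBy_iff.mp R.2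
    exact ⟨⟨P, hPn⟩, Subtype.ext (by rw [hψ₂val]; exact hP)⟩
  have hNθ : N ≤ ((resGalOfEmb (K := E) ι₂ :
      Field.absoluteGaloisGroup E' →ₜ* Field.absoluteGaloisGroup E) :
        Field.absoluteGaloisGroup E' →* Field.absoluteGaloisGroup E).range := fun g hg ↦ hg
  exact torsionLocalKer_eq_of_index_two W n ι₂ ψ₂ hψ₂val hψ₂ hbij N hNopen hNθ hτ2 hcov
    (hsolv σ hσN)

end Quadratic

end Summit.BirchSwinnertonDyer.BirchSwinnertonDyer.Theorems.KolyvaginInfResTwo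

end
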